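import Summits.ResolutionOfSingularities.ResolutionOfSingularities.Theorems.EquisingularLiftEquisingularLiftNatPointStepTransport
import Summits.ResolutionOfSingularities.ResolutionOfSingularities.Theorems.EquisingularLiftEquisingularLiftNatGoodPointDictionary
import Literature.AlgebraicGeometry.Resolution.BlowupReducedDimension
import HarnessLib

/-!
# [OURS · L1 W4.5(b) · EL♮(3)] `singular_point_descends` — point blow-ups at REGULAR points of a reduced closed subscheme create no
# non-regular points (crux `EquisingularLiftNatThree` = stmt-ResolutionOfSingularities-20148, parent stmt-20038; rung v7 (TC⁺),
# brick of res-L1-w45b-stub-1's HSUB(ReachTC⁺)₃ assembly, call-site row «`singular_point_descends` (S)»)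

NOT a statement of any manuscript. Helper file of the chain res-L1-w45b (cell `res-hironaka`, rung L, slot W4.5(b)); AI-written,
weaker than expert review; filed `--supports stmt-ResolutionOfSingularities-20148 --as helper`; it closes nothing.

WHERE IT SITS. In the INNER chain of the registered rung stub `stub_elnat_tcPlusPointResolution` (res-L1-w45b-lead-2, v7 (TC⁺),
K5 currency of res-D-pv-029) the downstairs ambient `G₁` is blown up at a closed point `y` of the running reduced curve
`V(closure Z)_red` which is a REGULAR point of that curve (flag kept), the curve being replaced by the reduced closed subscheme on
`closure υ₁⁻¹(Z ∖ {y})`. res-L1-w45b-stub-1's invariant (`inv_step_singular`, HSUB-TCPLUS3-skeleton 584ed9d307bb8435) needs: such a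
step creates NO new non-regular point — every non-regular point of the new curve lies over a non-regular point of the old one,
different from `y`. This file proves it in the set-level currency of the registered text, for ANY closed `T ⊆ G₁` (no
irreducibility, no dimension or finite-type hypothesis):

* `exists_isBlowup_reducedStrictTransform_closed` — the reduced strict transform `V(closure τ⁻¹(S ∖ V(C)))_red → V(S)_red` of an
  ARBITRARY closed `S` under a blow-up `τ` along `C` is a proper morphism over `τ` and a blow-up along `C·𝒪_{V(S)_red}` (the tree's
  `exists_isBlowup_reducedStrictTransform`, p-StrataSplit, asks `S` irreducible; here reducedness of blow-ups of reduced schemes,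
  `IsBlowup.isReduced_of_isReduced`, replaces integrality);
* `exists_isBlowup_reducedStrictTransform_point_closed` — the point case: `V(closure υ⁻¹(T ∖ {y}))_red → V(T)_red` is a blow-up of
  `V(T)_red` at the reduced closed point `y` (res-D-pv-029's `exists_isBlowup_reducedStrictTransform_point` without `IsIrreducible T`);
* **`isRegularLocalRing_stalk_reducedStrictTransform_of_over`** — (A) if `V(T)_red` is regular at `y`, the new curve is regular at
  every point over `y` (res-L1-w45b-stub-2's T-GOODPT-DICT `isRegularLocalRing_stalk_of_isBlowup_singleton`, Liu 8.1.19 (a));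
* **`isRegularLocalRing_stalk_reducedStrictTransform_iff_of_not_over`** — (B) at a point NOT over `y` the new curve is regular iff the
  old one is at the point below (off-centre stalk isomorphism);
* **`singular_point_descends`** — hence a non-regular point of the new curve lies over a non-regular point `≠ y` of the old one;
  `finite_setOf_not_isRegularLocalRing_reducedStrictTransform` — and finitely many non-regular points stay finitely many.

References: The Stacks Project, Tag 080E (1); Q. Liu, *Algebraic Geometry and Arithmetic Curves* (2002), Thm. 8.1.19 (a);
res-L1-w45b-stub-1 HSUB-TCPLUS3-skeleton (OURS planning text, index only).
-/

set_option linter.dupNamespace false -- mandated namespace `Summit.<Summit>.<Problem>` of this single-conjunct summit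

noncomputable section

open CategoryTheory CategoryTheory.Limits AlgebraicGeometry TopologicalSpace Topology
open Literature.AlgebraicGeometry.Resolution
open AlgebraicGeometry.Scheme.IdealSheafData
open Summit.ResolutionOfSingularities.ResolutionOfSingularities.Cruxes.EquisingularLift.StrataSplit

namespace Summit.ResolutionOfSingularities.ResolutionOfSingularities.Cruxes.EquisingularLiftNat.Sections

/-! ## The reduced strict transform of an arbitrary closed set is a blow-up -/

/-- **The reduced strict transform is the blow-up of `V(S)_red` along the restricted centre, for ANY closed `S`** (Stacks, Tag
080E (1), for the closed immersion `V(S)_red ↪ X`). For a blow-up `τ : X' → X` along `C` and a closed `S ⊆ X` there is a morphism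
`ρ` from the reduced closed subscheme of `X'` on `closure τ⁻¹(S ∖ V(C))` to `Z := V(S)_red`, over `τ`, proper, and a blow-up of `Z`
along `C.comap ι_S`. (Proof as the tree's irreducible case, with `IsBlowup.isReduced_of_isReduced` for the reduced `Z`.)
[cite: StacksProject, Tag 080E] -/
theorem exists_isBlowup_reducedStrictTransform_closed (X X' : Scheme.{0}) [IsLocallyNoetherian X] [IsLocallyNoetherian X']
    (τ : X' ⟶ X) (C : X.IdealSheafData) (hτ : IsBlowup τ C) [IsProper τ] (S : Set X) (hS : IsClosed S) :
    ∃ ρ : (vanishingIdeal (⟨closure (τ ⁻¹' (S \ (C.support : Set X))), isClosed_closure⟩ : Closeds X')).subscheme ⟶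
        (vanishingIdeal (⟨S, hS⟩ : Closeds X)).subscheme,
      ρ ≫ (vanishingIdeal (⟨S, hS⟩ : Closeds X)).subschemeι =
        (vanishingIdeal (⟨closure (τ ⁻¹' (S \ (C.support : Set X))), isClosed_closure⟩ : Closeds X')).subschemeι ≫ τ ∧
      IsProper ρ ∧ IsBlowup ρ (C.comap (vanishingIdeal (⟨S, hS⟩ : Closeds X)).subschemeι) := by
  let Z : Scheme.{0} := (vanishingIdeal (⟨S, hS⟩ : Closeds X)).subscheme
  let ιS : Z ⟶ X := (vanishingIdeal (⟨S, hS⟩ : Closeds X)).subschemeι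
  haveI : IsReduced Z := ComponentGluing.isReduced_subscheme_vanishingIdeal ⟨S, hS⟩
  haveI : IsLocallyNoetherian Z := LocallyOfFiniteType.isLocallyNoetherian ιS
  have hrangeS : Set.range ιS = S := by
    rw [Scheme.IdealSheafData.range_subschemeι, Scheme.IdealSheafData.coe_support_vanishingIdeal]
    rfl
  -- the scheme-theoretic strict transform `Z' ⊆ Z ×_X X'` and its projection `b' : Z' → Z`, a blow-up along `C.comap ιS`
  let ι' : blowupStrictTransform ιS τ C ⟶ pullback ιS τ := blowupStrictTransformι ιS τ C
  let b' : blowupStrictTransform ιS τ C ⟶ Z := ι' ≫ pullback.fst ιS τ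
  have hb' : IsBlowup b' (C.comap ιS) := isBlowup_blowupStrictTransform ιS τ C hτ
  let j : blowupStrictTransform ιS τ C ⟶ X' := ι' ≫ pullback.snd ιS τ
  haveI : IsClosedImmersion j := inferInstance
  have hj : j ≫ τ = b' ≫ ιS := by
    simp only [j, b', Category.assoc, pullback.condition]
  haveI : IsLocallyNoetherian (blowupStrictTransform ιS τ C) := LocallyOfFiniteType.isLocallyNoetherian j
  -- `Z'` is reduced (a blow-up of the reduced `Z`)
  haveI : IsReduced (blowupStrictTransform ιS τ C) := hb'.isReduced_of_isReduced
  have hrange : Set.range j = closure (τ ⁻¹' (S \ (C.support : Set X))) := by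
    rw [hτ.range_eq_strictTransformSet hb' hj j.isClosedEmbedding.isClosed_range, hrangeS]
    rfl
  have hker : (vanishingIdeal
      (⟨closure (τ ⁻¹' (S \ (C.support : Set X))), isClosed_closure⟩ : Closeds X')).subschemeι.ker = j.ker := by
    rw [Scheme.IdealSheafData.ker_subschemeι, ker_eq_vanishingIdeal_range j j.isClosedEmbedding.isClosed_range]
    congr 1
    exact Closeds.ext hrange.symm
  let e : blowupStrictTransform ιS τ C ⟶ (vanishingIdeal
      (⟨closure (τ ⁻¹' (S \ (C.support : Set X))), isClosed_closure⟩ : Closeds X')).subscheme :=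
    IsClosedImmersion.lift _ j hker.le
  haveI : IsIso e := IsClosedImmersion.isIso_lift _ j hker
  have he : e ≫ (vanishingIdeal
      (⟨closure (τ ⁻¹' (S \ (C.support : Set X))), isClosed_closure⟩ : Closeds X')).subschemeι = j :=
    IsClosedImmersion.lift_fac _ j hker.le
  have he' : inv e ≫ j = (vanishingIdeal
      (⟨closure (τ ⁻¹' (S \ (C.support : Set X))), isClosed_closure⟩ : Closeds X')).subschemeι := by
    rw [← he, IsIso.inv_hom_id_assoc]
  refine ⟨inv e ≫ b', ?_, ?_, ?_⟩
  · show (inv e ≫ b') ≫ ιS = _ ≫ τ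
    rw [Category.assoc, ← hj, ← Category.assoc, he']
  · have hc : IsProper ((inv e ≫ b') ≫ ιS) := by
      rw [Category.assoc, ← hj, ← Category.assoc, he']
      infer_instance
    exact MorphismProperty.of_postcomp (W := @AlgebraicGeometry.IsProper)
      (W' := @AlgebraicGeometry.IsSeparated) (inv e ≫ b') ιS inferInstance hc
  · exact hb'.iso_comp (asIso e).symm

/-! ## The point case -/

/-- **Point case, ANY closed `T`.** `F₁` locally Noetherian, `T ⊆ F₁` closed, `y` a point of `Γ₁ = V(T)_red` with `ι y` a closed
point of `F₁`, `υ : F₂ → F₁` a blow-up along the reduced point `ι y` with `F₂` locally Noetherian: the reduced strict transform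
`V(closure υ⁻¹(T ∖ {ι y}))_red` maps to `Γ₁` by a proper morphism over `υ` which is a BLOW-UP of `Γ₁` at the reduced point `y`
(res-D-pv-029's `exists_isBlowup_reducedStrictTransform_point` without irreducibility of `T`). [cite: StacksProject, Tag 080E (1)] -/
theorem exists_isBlowup_reducedStrictTransform_point_closed (F₁ F₂ : Scheme.{0}) [IsLocallyNoetherian F₁]
    [IsLocallyNoetherian F₂] (T : Set F₁) (hT : IsClosed T) (y : ↥(vanishingIdeal (⟨T, hT⟩ : Closeds F₁)).subscheme)
    (hy : IsClosed ({((vanishingIdeal (⟨T, hT⟩ : Closeds F₁)).subschemeι y : F₁)} : Set F₁))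
    (υ : F₂ ⟶ F₁) (hυ : IsBlowup υ (vanishingIdeal ⟨{((vanishingIdeal (⟨T, hT⟩ : Closeds F₁)).subschemeι y : F₁)}, hy⟩)) :
    ∃ (hcl : IsClosed ({y} : Set ↥(vanishingIdeal (⟨T, hT⟩ : Closeds F₁)).subscheme))
      (ρ : (vanishingIdeal (⟨closure (υ ⁻¹' (T \ {((vanishingIdeal (⟨T, hT⟩ : Closeds F₁)).subschemeι y : F₁)})),
          isClosed_closure⟩ : Closeds F₂)).subscheme ⟶ (vanishingIdeal (⟨T, hT⟩ : Closeds F₁)).subscheme),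
      ρ ≫ (vanishingIdeal (⟨T, hT⟩ : Closeds F₁)).subschemeι =
        (vanishingIdeal (⟨closure (υ ⁻¹' (T \ {((vanishingIdeal (⟨T, hT⟩ : Closeds F₁)).subschemeι y : F₁)})),
          isClosed_closure⟩ : Closeds F₂)).subschemeι ≫ υ ∧
      IsProper ρ ∧ IsBlowup ρ (vanishingIdeal ⟨{y}, hcl⟩) := by
  haveI : IsProper υ := hυ.isProper
  set ι₁ := (vanishingIdeal (⟨T, hT⟩ : Closeds F₁)).subschemeι with hι₁
  have hsupp : ((vanishingIdeal (⟨{(ι₁ y : F₁)}, hy⟩ : Closeds F₁)).support : Set F₁) = {(ι₁ y : F₁)} := by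
    rw [Scheme.IdealSheafData.coe_support_vanishingIdeal]; rfl
  obtain ⟨ρ, hρι, hρp, hρb⟩ := exists_isBlowup_reducedStrictTransform_closed F₁ F₂ υ _ hυ T hT
  have hcl : IsClosed ({y} : Set ↥(vanishingIdeal (⟨T, hT⟩ : Closeds F₁)).subscheme) := by
    have e : ({y} : Set _) = ι₁ ⁻¹' {(ι₁ y : F₁)} := by
      ext z
      simp only [Set.mem_singleton_iff, Set.mem_preimage]
      exact ⟨fun h => by rw [h], fun h => ι₁.isClosedEmbedding.injective h⟩
    rw [e]
    exact hy.preimage ι₁.continuous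
  have himg : (⟨ι₁ '' (({y} : Set _) : Set _), ι₁.isClosedEmbedding.isClosedMap _ hcl⟩ : Closeds F₁) =
      ⟨{(ι₁ y : F₁)}, hy⟩ := Closeds.ext (Set.image_singleton)
  have hcomap : (vanishingIdeal (⟨{(ι₁ y : F₁)}, hy⟩ : Closeds F₁)).comap ι₁ = vanishingIdeal ⟨{y}, hcl⟩ := by
    rw [← himg]
    exact comap_vanishingIdeal_image_of_isClosedImmersion ι₁ ⟨{y}, hcl⟩
  refine ⟨hcl, ?_⟩
  -- rewrite the support `{ι y}` in the type of `ρ`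
  revert ρ
  rw [hsupp, hcomap]
  intro ρ hρι hρp hρb
  exact ⟨ρ, hρι, hρp, hρb⟩

/-! ## `singular_point_descends` -/

section Descends

variable {F₁ F₂ : Scheme.{0}} [IsLocallyNoetherian F₁] [IsLocallyNoetherian F₂] {T : Set F₁} {hT : IsClosed T}
  {y : ↥(vanishingIdeal (⟨T, hT⟩ : Closeds F₁)).subscheme}
  {hy : IsClosed ({((vanishingIdeal (⟨T, hT⟩ : Closeds F₁)).subschemeι y : F₁)} : Set F₁)}
  {υ : F₂ ⟶ F₁}

/-- **(A) Over the blown-up regular point the new curve is regular.** If `V(T)_red` is regular at `y`, then the reduced strict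
transform `V(closure υ⁻¹(T ∖ {ι y}))_red` is regular at every point over `ι y`. [cite: Liu2002, Thm. 8.1.19 (a)]
[OURS · L1 W4.5b] -/
theorem isRegularLocalRing_stalk_reducedStrictTransform_of_over
    (hυ : IsBlowup υ (vanishingIdeal ⟨{((vanishingIdeal (⟨T, hT⟩ : Closeds F₁)).subschemeι y : F₁)}, hy⟩))
    (hreg : IsRegularLocalRing ((vanishingIdeal (⟨T, hT⟩ : Closeds F₁)).subscheme.presheaf.stalk y))
    (y₂ : ↥(vanishingIdeal (⟨closure (υ ⁻¹' (T \ {((vanishingIdeal (⟨T, hT⟩ : Closeds F₁)).subschemeι y : F₁)})),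
      isClosed_closure⟩ : Closeds F₂)).subscheme)
    (hover : υ ((vanishingIdeal (⟨closure (υ ⁻¹' (T \ {((vanishingIdeal (⟨T, hT⟩ : Closeds F₁)).subschemeι y : F₁)})),
      isClosed_closure⟩ : Closeds F₂)).subschemeι y₂) = (vanishingIdeal (⟨T, hT⟩ : Closeds F₁)).subschemeι y) :
    IsRegularLocalRing ((vanishingIdeal (⟨closure (υ ⁻¹' (T \ {((vanishingIdeal (⟨T, hT⟩ : Closeds F₁)).subschemeι y : F₁)})),
      isClosed_closure⟩ : Closeds F₂)).subscheme.presheaf.stalk y₂) := by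
  obtain ⟨hcl, ρ, hρι, -, hρb⟩ := exists_isBlowup_reducedStrictTransform_point_closed F₁ F₂ T hT y hy υ hυ
  have hρy : ρ y₂ = y := by
    apply (vanishingIdeal (⟨T, hT⟩ : Closeds F₁)).subschemeι.isClosedEmbedding.injective
    rw [← Scheme.Hom.comp_apply, hρι, Scheme.Hom.comp_apply]
    exact hover
  exact isRegularLocalRing_stalk_of_isBlowup_singleton hcl hρb y₂ hρy hreg

/-- **(B) Off the blown-up point nothing changes.** At a point `y₂` of the reduced strict transform NOT over `ι y`, and for the
point `y₁` of `V(T)_red` under it, `V(closure υ⁻¹(T ∖ {ι y}))_red` is regular at `y₂` iff `V(T)_red` is regular at `y₁`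
(the blow-up `ρ` of `V(T)_red` at `y` induces an isomorphism of stalks off `y`). [cite: StacksProject, Tag 02OS] [OURS · L1 W4.5b] -/
theorem isRegularLocalRing_stalk_reducedStrictTransform_iff_of_not_over
    (hυ : IsBlowup υ (vanishingIdeal ⟨{((vanishingIdeal (⟨T, hT⟩ : Closeds F₁)).subschemeι y : F₁)}, hy⟩))
    (y₂ : ↥(vanishingIdeal (⟨closure (υ ⁻¹' (T \ {((vanishingIdeal (⟨T, hT⟩ : Closeds F₁)).subschemeι y : F₁)})),
      isClosed_closure⟩ : Closeds F₂)).subscheme)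
    (y₁ : ↥(vanishingIdeal (⟨T, hT⟩ : Closeds F₁)).subscheme)
    (hunder : υ ((vanishingIdeal (⟨closure (υ ⁻¹' (T \ {((vanishingIdeal (⟨T, hT⟩ : Closeds F₁)).subschemeι y : F₁)})),
      isClosed_closure⟩ : Closeds F₂)).subschemeι y₂) = (vanishingIdeal (⟨T, hT⟩ : Closeds F₁)).subschemeι y₁)
    (hne : y₁ ≠ y) :
    IsRegularLocalRing ((vanishingIdeal (⟨closure (υ ⁻¹' (T \ {((vanishingIdeal (⟨T, hT⟩ : Closeds F₁)).subschemeι y : F₁)})),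
      isClosed_closure⟩ : Closeds F₂)).subscheme.presheaf.stalk y₂) ↔
      IsRegularLocalRing ((vanishingIdeal (⟨T, hT⟩ : Closeds F₁)).subscheme.presheaf.stalk y₁) := by
  obtain ⟨hcl, ρ, hρι, -, hρb⟩ := exists_isBlowup_reducedStrictTransform_point_closed F₁ F₂ T hT y hy υ hυ
  have hρy : ρ y₂ = y₁ := by
    apply (vanishingIdeal (⟨T, hT⟩ : Closeds F₁)).subschemeι.isClosedEmbedding.injective
    rw [← Scheme.Hom.comp_apply, hρι, Scheme.Hom.comp_apply]
    exact hunder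
  have hnot : ρ y₂ ∉ ((vanishingIdeal (⟨{y}, hcl⟩ : Closeds _)).support : Set _) := by
    rw [Scheme.IdealSheafData.coe_support_vanishingIdeal, hρy]
    exact fun h => hne (Set.mem_singleton_iff.mp h)
  haveI := hρb.isIso_stalkMap_of_not_mem_support hnot
  let e := (asIso (ρ.stalkMap y₂)).commRingCatIsoToRingEquiv
  rw [← hρy]
  exact ⟨fun h => IsRegularLocalRing.of_ringEquiv e.symm, fun h => IsRegularLocalRing.of_ringEquiv e⟩

/-- **`singular_point_descends`.** Blow up `F₁` at a closed point `ι y` at which the reduced curve `V(T)_red` is REGULAR. Then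
every NON-regular point `y₂` of the reduced strict transform `V(closure υ⁻¹(T ∖ {ι y}))_red` lies over a NON-regular point `y₁`
of `V(T)_red` different from `y`. [cite: Liu2002, Thm. 8.1.19 (a)] [OURS · L1 W4.5b] -/
theorem singular_point_descends
    (hυ : IsBlowup υ (vanishingIdeal ⟨{((vanishingIdeal (⟨T, hT⟩ : Closeds F₁)).subschemeι y : F₁)}, hy⟩))
    (hreg : IsRegularLocalRing ((vanishingIdeal (⟨T, hT⟩ : Closeds F₁)).subscheme.presheaf.stalk y))
    (y₂ : ↥(vanishingIdeal (⟨closure (υ ⁻¹' (T \ {((vanishingIdeal (⟨T, hT⟩ : Closeds F₁)).subschemeι y : F₁)})),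
      isClosed_closure⟩ : Closeds F₂)).subscheme)
    (h₂ : ¬ IsRegularLocalRing ((vanishingIdeal (⟨closure (υ ⁻¹' (T \ {((vanishingIdeal (⟨T, hT⟩ : Closeds F₁)).subschemeι y : F₁)})),
      isClosed_closure⟩ : Closeds F₂)).subscheme.presheaf.stalk y₂)) :
    ∃ y₁ : ↥(vanishingIdeal (⟨T, hT⟩ : Closeds F₁)).subscheme,
      υ ((vanishingIdeal (⟨closure (υ ⁻¹' (T \ {((vanishingIdeal (⟨T, hT⟩ : Closeds F₁)).subschemeι y : F₁)})),
        isClosed_closure⟩ : Closeds F₂)).subschemeι y₂) = (vanishingIdeal (⟨T, hT⟩ : Closeds F₁)).subschemeι y₁ ∧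
      y₁ ≠ y ∧ ¬ IsRegularLocalRing ((vanishingIdeal (⟨T, hT⟩ : Closeds F₁)).subscheme.presheaf.stalk y₁) := by
  obtain ⟨hcl, ρ, hρι, -, -⟩ := exists_isBlowup_reducedStrictTransform_point_closed F₁ F₂ T hT y hy υ hυ
  have hunder : υ ((vanishingIdeal (⟨closure (υ ⁻¹' (T \ {((vanishingIdeal (⟨T, hT⟩ : Closeds F₁)).subschemeι y : F₁)})),
      isClosed_closure⟩ : Closeds F₂)).subschemeι y₂) = (vanishingIdeal (⟨T, hT⟩ : Closeds F₁)).subschemeι (ρ y₂) := by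
    rw [← Scheme.Hom.comp_apply, ← hρι, Scheme.Hom.comp_apply]
  have hne : ρ y₂ ≠ y := by
    intro h
    rw [h] at hunder
    exact h₂ (isRegularLocalRing_stalk_reducedStrictTransform_of_over hυ hreg y₂ hunder)
  refine ⟨ρ y₂, hunder, hne, fun h₁ => h₂ ?_⟩
  exact (isRegularLocalRing_stalk_reducedStrictTransform_iff_of_not_over hυ y₂ (ρ y₂) hunder hne).mpr h₁

/-- **Finitely many non-regular points stay finitely many** under a point blow-up at a regular point of the reduced curve: the
non-regular points of the reduced strict transform inject (by `υ ∘ ι`) into the non-regular points of `V(T)_red`, over which the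
blow-up is an isomorphism. [cite: Liu2002, Thm. 8.1.19 (a)] [OURS · L1 W4.5b] -/
theorem finite_setOf_not_isRegularLocalRing_reducedStrictTransform
    (hυ : IsBlowup υ (vanishingIdeal ⟨{((vanishingIdeal (⟨T, hT⟩ : Closeds F₁)).subschemeι y : F₁)}, hy⟩))
    (hreg : IsRegularLocalRing ((vanishingIdeal (⟨T, hT⟩ : Closeds F₁)).subscheme.presheaf.stalk y))
    (hfin : {y₁ : ↥(vanishingIdeal (⟨T, hT⟩ : Closeds F₁)).subscheme |
      ¬ IsRegularLocalRing ((vanishingIdeal (⟨T, hT⟩ : Closeds F₁)).subscheme.presheaf.stalk y₁)}.Finite) :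
    {y₂ : ↥(vanishingIdeal (⟨closure (υ ⁻¹' (T \ {((vanishingIdeal (⟨T, hT⟩ : Closeds F₁)).subschemeι y : F₁)})),
        isClosed_closure⟩ : Closeds F₂)).subscheme |
      ¬ IsRegularLocalRing ((vanishingIdeal (⟨closure (υ ⁻¹' (T \ {((vanishingIdeal (⟨T, hT⟩ : Closeds F₁)).subschemeι y : F₁)})),
        isClosed_closure⟩ : Closeds F₂)).subscheme.presheaf.stalk y₂)}.Finite := by
  obtain ⟨hcl, ρ, hρι, -, hρb⟩ := exists_isBlowup_reducedStrictTransform_point_closed F₁ F₂ T hT y hy υ hυ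
  -- the non-regular points map into the non-regular points of `V(T)_red` off `y`, where `ρ` is injective
  have hsub : ∀ y₂, ¬ IsRegularLocalRing ((vanishingIdeal (⟨closure (υ ⁻¹' (T \ {((vanishingIdeal (⟨T, hT⟩ : Closeds F₁)).subschemeι
      y : F₁)})), isClosed_closure⟩ : Closeds F₂)).subscheme.presheaf.stalk y₂) →
      ρ y₂ ≠ y ∧ ¬ IsRegularLocalRing ((vanishingIdeal (⟨T, hT⟩ : Closeds F₁)).subscheme.presheaf.stalk (ρ y₂)) := by
    intro y₂ h₂
    have hunder : υ ((vanishingIdeal (⟨closure (υ ⁻¹' (T \ {((vanishingIdeal (⟨T, hT⟩ : Closeds F₁)).subschemeι y : F₁)})),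
        isClosed_closure⟩ : Closeds F₂)).subschemeι y₂) = (vanishingIdeal (⟨T, hT⟩ : Closeds F₁)).subschemeι (ρ y₂) := by
      rw [← Scheme.Hom.comp_apply, ← hρι, Scheme.Hom.comp_apply]
    have hne : ρ y₂ ≠ y := by
      intro h
      rw [h] at hunder
      exact h₂ (isRegularLocalRing_stalk_reducedStrictTransform_of_over hυ hreg y₂ hunder)
    exact ⟨hne, fun h₁ => h₂
      ((isRegularLocalRing_stalk_reducedStrictTransform_iff_of_not_over hυ y₂ (ρ y₂) hunder hne).mpr h₁)⟩
  -- injectivity of `ρ` off the centre `{y}`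
  set U : (vanishingIdeal (⟨T, hT⟩ : Closeds F₁)).subscheme.Opens := centreCompl (vanishingIdeal (⟨{y}, hcl⟩ : Closeds _))
    with hU
  haveI : IsIso (ρ ∣_ U) := hρb.isIso_compl
  have hUeq : (U : Set _) = ({y} : Set _)ᶜ := by
    show (((vanishingIdeal (⟨{y}, hcl⟩ : Closeds _)).support :
        Set ↥(vanishingIdeal (⟨T, hT⟩ : Closeds F₁)).subscheme))ᶜ = _
    rw [Scheme.IdealSheafData.coe_support_vanishingIdeal]
    rfl
  have hinj : Set.InjOn (fun y₂ => ρ y₂) (ρ ⁻¹' ({y} : Set _)ᶜ) := by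
    intro a ha b hb hab
    have ha' : a ∈ ρ ⁻¹ᵁ U := by
      show ρ a ∈ (U : Set _)
      rw [hUeq]; exact ha
    have hb' : b ∈ ρ ⁻¹ᵁ U := by
      show ρ b ∈ (U : Set _)
      rw [hUeq]; exact hb
    have heq : (ρ ∣_ U) ⟨a, ha'⟩ = (ρ ∣_ U) ⟨b, hb'⟩ := by
      apply Subtype.ext
      rw [morphismRestrict_base_coe, morphismRestrict_base_coe]
      exact hab
    exact congrArg Subtype.val ((ρ ∣_ U).isOpenEmbedding.injective heq)
  refine Set.Finite.of_finite_image ?_ (hinj.mono ?_)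
  · refine hfin.subset ?_
    rintro _ ⟨y₂, h₂, rfl⟩
    exact (hsub y₂ h₂).2
  · intro y₂ h₂
    exact fun h => (hsub y₂ h₂).1 (Set.mem_singleton_iff.mp h)

end Descends

end Summit.ResolutionOfSingularities.ResolutionOfSingularities.Cruxes.EquisingularLiftNat.Sections

end
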